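import Summits.HodgeConjecture.HodgeConjecture.Theorems.UeP4bLocalPeriodMatrix
import HarnessLib

/-!
# U-e P4 (B1b): Siegel-normalised Hodge-frame markings of the fibres of the universal family, with
# chart-holomorphic period point — the socket `UHead.Ue_P4b1b_hodgeFrameMarkings`, notion-free

Cell hodgecm-mathlib (D-0151), rung 0 of the Mumford line under `HDel` (item `stmt-HodgeConjecture-24835`), (U)-lane
node U-e («the analytic clauses of the complex uniformisation of the Siegel fine moduli scheme»), socket P4 («local
holomorphic period map around an admissible point»), third layer v0.6/v0.7 (P4 lead B-p03 (g13/g14); socket texts by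
B-typ02 (g11)): this file proves the socket **(B1b) `UHead.Ue_P4b1b_hodgeFrameMarkings`** in TREE SHAPE (the HOME notions
`SiegelMarkingFamily` / `IsMarkingFrame` / `IsFlatGram` / `IsSiegelNormalised` / `IsFlatIntegralFrame` of the socket text
unfolded to their definientia; the glue re-packages in three lines), assembling the two engines of
`Theorems/UeP4bLocalPeriodMatrix.lean` (§1–§3 below refer to that file).  HC_CM is proved only modulo the 7 printed
citations until rung 0 closes; nothing in this file changes that count (a (U)-road leaf, books 0).

THE STATEMENT (`ueP4b1b_hodgeFrameMarkings`).  Data on a path-connected open `W ⊆ (M ⊗ ℂ)(ℂ)` inside an algebraic chart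
— delivered by (B1a) ★ `ue_P4b1a_flatFrameUniformisations_holds` in this binder order —: fibre triples `P′ x` of the universal
triple with base-change witnesses `(G, Ĝ)` (pinned identifications `e x : A_x(ℂ) ≃ₜ X_x(ℂ)`, `A_x := ((P′ x).A.fibre 𝟙).toAbelianVariety`,
`X_x` the fibre of `univFamilyℂ 𝓜`), a frame `γ` of `H¹(X_x; ℚ)` flat inside `W`, additive analytifications
`φ x : ℂ^g/Φ_x(ℤ^{2g}) → A_x(ℂ)` framing `γ x` through `e x`, ample `IsLambdaOfAt` witnesses `Θ x`, and at `x₀` a marking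
`m₀` by `[J(Z₀), r]` with `γ = 1`, `Ψ = Φ x₀`, `toFun = φ x₀` and a symplectic lift `Λ₀` matched to `m₀`'s torsion tower;
plus (G₀) «the Appell–Humbert Gram of `𝒪(Θ x₀)^an` is `E_δ`» and (N3) «the Gram is constant on `W`».  Conclusion: a period
map `π : (M ⊗ ℂ)(ℂ) → M_g(ℂ)`, points `J x ∈ S^±` and T1′ markings `mark x` of `A_x` by `[J x, r]` which ARE the given
uniformisations, frame `γ x` through `e x`, have Gram `E_δ`, satisfy `J x = J(π x)`, with `π` continuous on `W`,
HOLOMORPHIC IN EVERY ALGEBRAIC CHART over `W`, `π x₀ = Z₀`, and the level sections reading through `mark x₀` at `eᵢ/N`.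

THE PROOF (§1–§3 in `UeP4bLocalPeriodMatrix`).
* §1 currency transport (`gramClause_of_marking`, `gramClause_to_marking`, `frameClause_to_marking`): statements about a
  marking's own uniformisation `(m.Ψ, m.toFun)` versus an equal one `(Φ, φ)` (destructure, `subst`, `funext`).
* §2 `exists_marking_of_gramClause` — PER FIBRE ([Milne2005ShimuraVarieties] proof of Thm. 6.11; [LangeBirkenhake1992]
  Prop. 8.1.1): the Riemann form of `𝒪(Θ)^an` (★ `exists_ahData_isRiemannForm_of_isAmple`) has lattice Gram `E_δ`
  (★ `map_intGram`), so `Z := Δ Π_μ⁻¹ Π_λ ∈ 𝔥_g` for the period matrix `Π` of `Φ` in the standard coframe, `Φ` is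
  `J(Z)`-linear (★ `siegelPoint_of_latticeGram_eq_typeForm`) and `A` is marked by `[J(Z), r]` with `γ = 1`, `Ψ = Φ`,
  `toFun = φ` (★ `exists_siegelAdelicMarking_of_latticeGram_eq_typeForm`).
* §3 `exists_local_periodMatrix` — THE LOCAL PERIOD FORMULA ([VoisinHodgeI2002] Thm. 10.3 + Thm. 10.9; [Griffiths1968PeriodsII]):
  Griffiths' theorem with PINNED algebraic chart (★ `griffiths1968_holomorphicHodgeSubbundlesQP_algebraicChart`) run DIRECTLY
  on `univFamilyℂ 𝓜` (inputs (U)-free: ★ `isSmoothProjectiveFamily_univFamilyℂ_of_classify`, (F-c′)/(F-c″)) at `t₁ ∈ W`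
  gives holomorphic frames `wᵢ(t)` of `F¹H¹(X_t)` on `H¹(X_{t₁})`; rational transport along a path of the Griffiths ball
  (★ `exists_ratTransport`) and the pinned iso carry them to `(1,0)`-frames of `A_t` (★ `hodgeFrame_transport_of_iso`;
  `r = g` by ★ `card_hodgeFrame_eq_dim_of_iso`), whose canonical-lattice-coordinate matrix `P(t)` computes
  `π t = Δ P(t)_μ⁻¹ P(t)_λ` (★ `siegelPoint_eq_of_hodgeFrame_of_apply_jOfSiegel`) and is entrywise a FIXED functional of
  `wᵢ(t)` (★ `latticeCoord_transport_eq_fixedFunctional'`: the frame `γ` is flat and is the markings' lattice frame), hence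
  analytic in the chart (★ `analyticOnNhd_comp_algebraicChart_symm_of_univ`).
* §4 the head: `π :=` the §2 formula on `W` (`0` outside); `IsMarkingFrame`/`IsFlatGram`/`IsSiegelNormalised` clauses by §1;
  continuity and chart-holomorphy on `W` patched from §3 through ★ P4d `differentiableOn_siegelPoint_of_periodMatrix` and ★
  `differentiableOn_comp_algebraicChart_symm_of_differentiableOn` on the open pieces `target ∩ symm⁻¹ W₂`; `π x₀ = Z₀` by ★
  `siegelPoint_eq_of_apply_jOfSiegel` (the marking `m₀`); the level reading from `Λ₀` (★ `lift_level`,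
  ★ `exists_adelicCongr_inv_one`, ★ `r_eq_toFun_proj_of_γ_eq_one`).

## References

* [LangeBirkenhake1992] H. Lange, Ch. Birkenhake, *Complex Abelian Varieties* (1992), Ch. 8 §8.1–8.2 (Prop. 8.1.1).
* [VoisinHodgeI2002] C. Voisin, *Hodge Theory and Complex Algebraic Geometry I* (2002), §9.2.1, §10.1.2 Thm. 10.9, §10.2.1 Thm. 10.3.
* [Griffiths1968PeriodsII] P. Griffiths, Periods of integrals on algebraic manifolds II, Amer. J. Math. 90 (1968), Thm. 1.1.
* [Milne2005ShimuraVarieties] J. S. Milne, *Introduction to Shimura Varieties* (2005), §6 Thm. 6.11 pp. 74–75, §12 (63) p. 116.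
* [Lange2023AbelianVarietiesComplex] H. Lange, *Abelian Varieties over the Complex Numbers* (2023), §1.1.3 Lemma 1.1.17 (a) (p. 14),
  §2.1.3 Prop. 2.1.11 (p. 80), §7.1.2 Lemma 7.1.6 (pp. 350–352).
* [MumfordFogartyKirwan1994] D. Mumford, J. Fogarty, F. Kirwan, *Geometric Invariant Theory* (3rd ed.), Appendix to Ch. 7 §A (p. 235).
-/

set_option autoImplicit false
set_option linter.dupNamespace false

noncomputable section

open CategoryTheory CategoryTheory.Limits AlgebraicGeometry Matrix Topology
open Literature.AlgebraicGeometry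
open scoped TensorProduct Manifold
open Literature.AlgebraicGeometry.Motives (SchemeOver ComplexPoints AlgPoints specOver AbelianVariety CartierDivisor fiberOver
  IsSmoothProjective ofRatClassBaseChange)
open Literature.AlgebraicGeometry.AbelianSchemes (PolarizedAbelianSchemeWithLevel AbelianSchemeOver)
open Literature.Geometry.Kaehler (ComplexTorus)
open Literature.Geometry.Kaehler.ComplexTorus (AHData periodMatrix intGram latticeGram IsRiemannForm proj picClass)
open Literature.NumberTheory.Transcendental (IsAnalytification)
open Literature.NumberTheory.Automorphic (siegelUpperHalfSpace)
open Literature.NumberTheory.Adeles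
open Literature.AlgebraicTopology.SingularHomology
open Literature.AlgebraicGeometry.ModuliOfAbelianVarieties
open Literature.AlgebraicGeometry.HodgeTheory

namespace Summit.HodgeConjecture.HodgeConjecture.Theorems

namespace UeP4bHodgeFrameMarkings

open SiegelModuli
/-! ### §4 The socket `UHead.Ue_P4b1b_hodgeFrameMarkings`, notion-free -/

section Main

/-- **U-e P4 (B1b) — SIEGEL-NORMALISED HODGE-FRAME MARKINGS (the socket `UHead.Ue_P4b1b_hodgeFrameMarkings` of the U-e P4
third layer v0.6, B-typ02 (g11)'s text + (α), NOTION-FREE filing shape).**  HYPOTHESES = the socket's, token for token, except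
that B-typ02's HOME notion `IsFlatIntegralFrame (univFamilyℂ 𝓜) hU γ` is replaced by its clause (iii) (flatness of `γ` for
transport inside `W`; clauses (i)/(ii) are not used).  CONCLUSION = the socket's with the HOME notions `SiegelMarkingFamily` /
`IsMarkingFrame` / `IsFlatGram` / `IsSiegelNormalised` unfolded: a period map `π`, points `J x ∈ S^±` and T1′ markings `mark x`
of the fibres `A_x = ((P′ x).A.fibre 𝟙).toAbelianVariety` by `[J x, r]` which ARE the given uniformisations (`γ = 1`, `Ψ = Φ x`,
`toFun = φ x`), whose lattice frames through the pinned `e x` are `γ x`, whose line bundles `𝒪(Θ x)^an` have Appell–Humbert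
Gram `E_δ`, with `J x = J(π x)`, `π` continuous on `W` and holomorphic in every algebraic chart, `π x₀ = Z₀`, and the level
sections reading through `mark x₀` at the classes `eᵢ/N`.  The glue re-packages `(J, mark)` as a `SiegelMarkingFamily`.
PROOF: §2 at every fibre (Gram `E_δ` everywhere from (G₀) at `x₀`, §1, and the flat-Gram hypothesis (N3)); `π x₀ = Z₀` by ★
`siegelPoint_eq_of_apply_jOfSiegel` (the admissibility marking `m₀` has `γ = 1`, `Ψ = Φ x₀`); the level reading from `Λ₀`'s
tower (★ `lift_level`, ★ `exists_adelicCongr_inv_one`); continuity and chart-holomorphy of `π` on `W` from the local period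
formula §3, ★ P4d `differentiableOn_siegelPoint_of_periodMatrix` and the chart transfer ★
`differentiableOn_comp_algebraicChart_symm_of_differentiableOn`.  HC_CM is proved only modulo the 7 printed citations until
rung 0 closes; this helper changes no count (books 0). [cite: LangeBirkenhake1992, Ch. 8 §8.1–8.2 (Prop. 8.1.1)]
[cite: VoisinHodgeI2002, §10.2.1 Thm. 10.3 and §10.1.2 Thm. 10.9] [cite: Milne2005ShimuraVarieties, §6 Thm. 6.11 pp. 74–75 and §12 (63) p. 116]
[cite: Lange2023AbelianVarietiesComplex, §7.1.2 Lemma 7.1.6 (pp. 350–352)] -/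
theorem ueP4b1b_hodgeFrameMarkings :
  ∀ (g N : ℕ) (δ : Fin g → ℕ) (_hg : 0 < g) (hδ : IsPolarizationType δ) (_hN : 3 ≤ N)
    (𝓜 : SiegelFineModuliScheme g N δ) (_hMq : IsQuasiProjectiveOver 𝓜.M)
    (_hXq : IsQuasiProjectiveOver (W1.univTotal 𝓜))
    (r : gspFinAdelic δ)
    (d : ℕ) [SmoothOfRelativeDimension d ((Motives.baseChange ℚ ℂ).obj 𝓜.M).hom],
    haveI : IsLocallyNoetherian (specOver ℚ ℂ).left :=
      inferInstanceAs (IsLocallyNoetherian (Spec (CommRingCat.of ℂ)))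
    haveI : Smooth ((Motives.baseChange ℚ ℂ).obj 𝓜.M).hom := SmoothOfRelativeDimension.smooth d _
    haveI : LocallyOfFiniteType ((Motives.baseChange ℚ ℂ).obj 𝓜.M).hom := inferInstance
    r ∈ principalLevelSubgroup δ 1 →
    ∀ (Z₀ : Matrix (Fin g) (Fin g) ℂ) (hZ₀ : Z₀ ∈ siegelUpperHalfSpace g)
      (W : Set (ComplexPoints ((Motives.baseChange ℚ ℂ).obj 𝓜.M))) (_hWo : IsOpen W) (_hW : IsPathConnected W)
      (x₀ : W)
      (_hWc : W ⊆ (ComplexPoints.algebraicChart ((Motives.baseChange ℚ ℂ).obj 𝓜.M) d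
        (x₀ : ComplexPoints ((Motives.baseChange ℚ ℂ).obj 𝓜.M))).source)
      (hU : IsCohomologicallyLocallyTrivialOn (W1.univFamilyℂ 𝓜) W)
      (P' : W → PolarizedAbelianSchemeWithLevel g N δ (specOver ℚ ℂ).left)
      (G : ∀ x : W, (P' x).A.X.left ⟶ 𝓜.univ.A.X.left) (Ĝ : ∀ x : W, (P' x).D.hat.X.left ⟶ 𝓜.univ.D.hat.X.left)
      (hbc : ∀ x : W, (P' x).IsBaseChangeVia 𝓜.univ
        ((AlgPoints.baseChangeEquiv (algebraMap ℚ ℂ) 𝓜.M).symm x.1).left (G x) (Ĝ x))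
      (γ : ∀ x : W, Fin g ⊕ Fin g →
        singularCohomology ℚ ℚ (ComplexPoints (fiberOver (W1.univFamilyℂ 𝓜) x.1)) 1)
      (Φ : ∀ _x : W, (Fin g ⊕ Fin g → ℝ) ≃L[ℝ] (Fin g → ℂ))
      (φ : ∀ x : W, C(ComplexTorus (Φ x), ((P' x).A.fibre (𝟙 (Spec (CommRingCat.of ℂ)))).toAbelianVariety.Points ℂ))
      (Θ : ∀ x : W, CartierDivisor ((P' x).A.fibre (𝟙 (Spec (CommRingCat.of ℂ)))).toAbelianVariety.X.left)
      (m₀ : SiegelAdelicMarking ⟨jOfSiegel δ Z₀, SiegelComplexRecordSystem.jOfSiegel_mem_C0pm hδ.1 hZ₀⟩ r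
        ((P' x₀).A.fibre (𝟙 (Spec (CommRingCat.of ℂ)))).toAbelianVariety)
      (Λ₀ : (P' x₀).level.SymplecticLift (𝟙 (Spec (CommRingCat.of ℂ))) (Θ x₀) δ),
      (∀ x : W, AlgPoints.baseChangeEquiv (algebraMap ℚ ℂ) 𝓜.M (𝓜.classifyingMap (specOver ℚ ℂ) (P' x)) = x.1) →
      -- (N1) `γ` is a flat integral frame over `W`: the three clauses of B-typ02's HOME notion
      -- `HodgeTheory.IsFlatIntegralFrame (W1.univFamilyℂ 𝓜) hU γ` (only (iii), flatness inside `W`, is used here)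
      ((∀ x : W, LinearIndependent ℂ fun a => ofRatClass _ 1 (γ x a)) ∧
        (∀ (x : W) (c : complexBetti (fiberOver (W1.univFamilyℂ 𝓜) x.1) 1),
          IsIntegralClass c ↔ c ∈ Submodule.span ℤ (Set.range fun a => ofRatClass _ 1 (γ x a))) ∧
        ∀ (x x' : W) (p : Path.Homotopic.Quotient x x') (a : Fin g ⊕ Fin g),
          transportFun (W1.univFamilyℂ 𝓜) 1 hU p (ofRatClass _ 1 (γ x a)) = ofRatClass _ 1 (γ x' a)) →
      -- the uniformisations: analytifications, additive, framed by `γ x` through the pinned `e x`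
      (hφ : ∀ x : W, IsAnalytification (Fin g → ℂ)
        ((P' x).A.fibre (𝟙 (Spec (CommRingCat.of ℂ)))).toAbelianVariety.X
        ((P' x).A.fibre (𝟙 (Spec (CommRingCat.of ℂ)))).toAbelianVariety.dim (φ x)) →
      (∀ (x : W) (s t : ComplexTorus (Φ x)), φ x (s + t) = φ x s * φ x t) →
      (∀ (x : W) (a : Fin g ⊕ Fin g),
        singularCohomology.map ℚ ℚ
            (((Motives.AlgPoints.homeomorphOfIso (L := ℂ)
                (W1.fibreAVIso (P' x) ≪≫
                  (W1.fiberUnivIsoOfIsBaseChangeVia 𝓜 x.1 (P' x) (G x) (Ĝ x) (hbc x)).symm) :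
                ((P' x).A.fibre (𝟙 (Spec (CommRingCat.of ℂ)))).toAbelianVariety.Points ℂ ≃ₜ
                  ComplexPoints (fiberOver (W1.univFamilyℂ 𝓜) x.1)) :
              C(((P' x).A.fibre (𝟙 (Spec (CommRingCat.of ℂ)))).toAbelianVariety.Points ℂ,
                ComplexPoints (fiberOver (W1.univFamilyℂ 𝓜) x.1))).comp (φ x)) 1 (γ x a) =
          latticeClass (Φ x) a) →
      (∀ x : W, (Θ x).IsAmple) →
      (∀ x : W, (P' x).A.IsLambdaOfAt (𝟙 (Spec (CommRingCat.of ℂ))) (P' x).D (P' x).pol.lam (Θ x)) →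
      -- base case at `x₀`
      m₀.γ = 1 → m₀.Ψ = Φ x₀ → (∀ t : ComplexTorus (Φ x₀), m₀.toFun t = φ x₀ t) →
      (∀ ⦃M : ℕ⦄, N ∣ M → M ≠ 0 → ∀ (c : Fin g ⊕ Fin g → ZMod M) (v : Fin g ⊕ Fin g → ℚ),
        AdelicCongr ((r⁻¹ : gspFinAdelic δ) : GL (Fin g ⊕ Fin g) finAdeleQ) 1 v (fun i => ((c i).val : ℚ) / M) →
          ((Λ₀.lift M (Multiplicative.ofAdd c)) :
              ((P' x₀).A.fibre (𝟙 (Spec (CommRingCat.of ℂ)))).toAbelianVariety.Points ℂ) = m₀.r v) →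
      -- Gram `E_δ` at `x₀` in `m₀`'s currency ((G₀))
      (∀ p : ComplexTorus.AHData m₀.Ψ,
        ComplexTorus.AHData.toPic p =
            ComplexTorus.picClass (cartierDivisorLineBundle m₀.isAnalytification (Θ x₀)) →
          ComplexTorus.intGram m₀.Ψ p.form = typeForm δ) →
      -- flat Gram ((N3-core))
      (∀ (x₁ x : W) (p₁ : ComplexTorus.AHData (Φ x₁)) (p : ComplexTorus.AHData (Φ x)),
        ComplexTorus.AHData.toPic p₁ =
            ComplexTorus.picClass (cartierDivisorLineBundle (hφ x₁) (Θ x₁)) →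
        ComplexTorus.AHData.toPic p =
            ComplexTorus.picClass (cartierDivisorLineBundle (hφ x) (Θ x)) →
        ComplexTorus.intGram (Φ x) p.form = ComplexTorus.intGram (Φ x₁) p₁.form) →
      ∃ (π : ComplexPoints ((Motives.baseChange ℚ ℂ).obj 𝓜.M) → Matrix (Fin g) (Fin g) ℂ)
        (J : W → C0pm δ)
        (mark : ∀ x : W, SiegelAdelicMarking (J x) r ((P' x).A.fibre (𝟙 (Spec (CommRingCat.of ℂ)))).toAbelianVariety),
        -- the markings ARE the given uniformisations
        (∀ x : W, (mark x).γ = 1) ∧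
        (∀ x : W, (mark x).Ψ = Φ x) ∧
        (∀ (x : W) (t : ComplexTorus (Φ x)), (mark x).toFun t = φ x t) ∧
        -- `IsMarkingFrame e γ`, unfolded
        (∀ (x : W) (a : Fin g ⊕ Fin g),
          singularCohomology.map ℚ ℚ
              (((Motives.AlgPoints.homeomorphOfIso (L := ℂ)
                  (W1.fibreAVIso (P' x) ≪≫
                    (W1.fiberUnivIsoOfIsBaseChangeVia 𝓜 x.1 (P' x) (G x) (Ĝ x) (hbc x)).symm) :
                  ((P' x).A.fibre (𝟙 (Spec (CommRingCat.of ℂ)))).toAbelianVariety.Points ℂ ≃ₜ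
                    ComplexPoints (fiberOver (W1.univFamilyℂ 𝓜) x.1)) :
                C(((P' x).A.fibre (𝟙 (Spec (CommRingCat.of ℂ)))).toAbelianVariety.Points ℂ,
                  ComplexPoints (fiberOver (W1.univFamilyℂ 𝓜) x.1))).comp
                ⟨(mark x).toFun, (mark x).isAnalytification.isHomeomorph.continuous⟩) 1 (γ x a) =
            latticeClass (mark x).Ψ a) ∧
        -- `IsFlatGram Θ`, unfolded
        (∀ x : W, ∃ p : ComplexTorus.AHData (mark x).Ψ,
          ComplexTorus.AHData.toPic p =
              ComplexTorus.picClass (cartierDivisorLineBundle (mark x).isAnalytification (Θ x)) ∧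
            ComplexTorus.intGram (mark x).Ψ p.form = typeForm δ) ∧
        -- `IsSiegelNormalised hδ (fun x ↦ π x.1)`, unfolded
        (∀ x : W, ∃ hx : π x.1 ∈ siegelUpperHalfSpace g,
          J x = ⟨jOfSiegel δ (π x.1), SiegelComplexRecordSystem.jOfSiegel_mem_C0pm hδ.1 hx⟩) ∧
        ContinuousOn π W ∧
        (∀ x ∈ W, ∀ (i j : Fin g),
          DifferentiableOn ℂ
            ((fun y ↦ π y i j) ∘ (ComplexPoints.algebraicChart ((Motives.baseChange ℚ ℂ).obj 𝓜.M) d x).symm)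
            ((ComplexPoints.algebraicChart ((Motives.baseChange ℚ ℂ).obj 𝓜.M) d x).target ∩
              (ComplexPoints.algebraicChart ((Motives.baseChange ℚ ℂ).obj 𝓜.M) d x).symm ⁻¹' W)) ∧
        π (x₀ : ComplexPoints ((Motives.baseChange ℚ ℂ).obj 𝓜.M)) = Z₀ ∧
        (∀ i : Fin g ⊕ Fin g, ∃ v : Fin g ⊕ Fin g → ℚ,
          AdelicCongr ((r⁻¹ : gspFinAdelic δ) : GL (Fin g ⊕ Fin g) finAdeleQ) 1 v
              (fun j => (((Pi.single i (1 : ZMod N) : Fin g ⊕ Fin g → ZMod N) j).val : ℚ) / N) ∧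
            (P' x₀).A.restrictPt (𝟙 (Spec (CommRingCat.of ℂ))) ((P' x₀).level.σ i) = (mark x₀).r v) := by
  intro g N δ hg hδ hN 𝓜 hMq hXq r d _ hr Z₀ hZ₀ W hWo _hWpc x₀ _hWc hU P' G Ĝ hbc γ Φ φ Θ m₀ Λ₀ _hcls hN1 hφ hadd
    hframe hΘ _hlam hγ₀ hΨ₀ hu₀ htower hG₀ hconst
  have hflat := hN1.2.2
  classical
  haveI : IsLocallyNoetherian (specOver ℚ ℂ).left :=
    inferInstanceAs (IsLocallyNoetherian (Spec (CommRingCat.of ℂ)))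
  haveI : Smooth ((Motives.baseChange ℚ ℂ).obj 𝓜.M).hom := SmoothOfRelativeDimension.smooth d _
  haveI : LocallyOfFiniteType ((Motives.baseChange ℚ ℂ).obj 𝓜.M).hom := inferInstance
  have hN0 : N ≠ 0 := by omega
  -- (G₀) in the currency `(Φ x₀, φ x₀)`, and the Gram `E_δ` at EVERY fibre by the flat-Gram hypothesis
  have hG₀' := gramClause_of_marking m₀ hΨ₀ hu₀ (hφ x₀) (Θ x₀) hG₀
  obtain ⟨-, -, ⟨p₀, hp₀, hGp₀⟩, -⟩ := exists_marking_of_gramClause hδ _ (φ x₀) (hφ x₀) (hadd x₀) (Θ x₀) (hΘ x₀) hG₀' hr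
  have hG : ∀ (x : W) (p : ComplexTorus.AHData (Φ x)),
      ComplexTorus.AHData.toPic p = ComplexTorus.picClass (cartierDivisorLineBundle (hφ x) (Θ x)) →
        ComplexTorus.intGram (Φ x) p.form = typeForm δ := fun x p hp ↦ by
    rw [hconst x₀ x p₀ p hp₀ hp, hGp₀]
  -- the per-fibre markings (§2)
  have hfib := fun x : W ↦ exists_marking_of_gramClause hδ _ (φ x) (hφ x) (hadd x) (Θ x) (hΘ x) (hG x) hr
  choose hZ hJ hAH mark hmγ hmΨ hmu hmr using hfib
  -- the period map: `Δ · Π(Φ x)_μ⁻¹ · Π(Φ x)_λ` on `W`, `0` outside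
  set πW : W → Matrix (Fin g) (Fin g) ℂ := fun x ↦
    Matrix.diagonal (fun i ↦ (δ i : ℂ)) * ((periodMatrix (Pi.basisFun ℂ (Fin g)) (Φ x)).toCols₂)⁻¹ *
      (periodMatrix (Pi.basisFun ℂ (Fin g)) (Φ x)).toCols₁ with hπW
  set π : ComplexPoints ((Motives.baseChange ℚ ℂ).obj 𝓜.M) → Matrix (Fin g) (Fin g) ℂ := fun y ↦
    if h : y ∈ W then πW ⟨y, h⟩ else 0 with hπdef
  have hππW : ∀ x : W, π x.1 = πW x := fun x ↦ by
    simp only [hπdef, dif_pos x.2]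
  -- the local period formula (§3) and what it gives in every algebraic chart
  have hloc : ∀ (t : ComplexPoints ((Motives.baseChange ℚ ℂ).obj 𝓜.M)) (ht : t ∈ W),
      ∃ W₂ : Set (ComplexPoints ((Motives.baseChange ℚ ℂ).obj 𝓜.M)), IsOpen W₂ ∧ t ∈ W₂ ∧ W₂ ⊆ W ∧
        W₂ ⊆ (ComplexPoints.algebraicChart ((Motives.baseChange ℚ ℂ).obj 𝓜.M) d t).source ∧
        ∀ (x : ComplexPoints ((Motives.baseChange ℚ ℂ).obj 𝓜.M)) (i j : Fin g),
          DifferentiableOn ℂ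
            ((fun y ↦ π y i j) ∘ (ComplexPoints.algebraicChart ((Motives.baseChange ℚ ℂ).obj 𝓜.M) d x).symm)
            ((ComplexPoints.algebraicChart ((Motives.baseChange ℚ ℂ).obj 𝓜.M) d x).target ∩
              (ComplexPoints.algebraicChart ((Motives.baseChange ℚ ℂ).obj 𝓜.M) d x).symm ⁻¹' W₂) := by
    intro t ht
    obtain ⟨W₂, hW₂o, htW₂, hW₂W, hW₂c, P, hPan, hPf⟩ := exists_local_periodMatrix hδ 𝓜 hMq hXq d hWo hU P' G Ĝ hbc γ
      hflat Φ φ hφ hframe πW hZ hJ ⟨t, ht⟩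
    refine ⟨W₂, hW₂o, htW₂, hW₂W, hW₂c, fun x i j ↦ ?_⟩
    set ct := ComplexPoints.algebraicChart ((Motives.baseChange ℚ ℂ).obj 𝓜.M) d t with hct
    -- in the chart at `t`: the period formula is differentiable (P4d)
    set F : ComplexPoints ((Motives.baseChange ℚ ℂ).obj 𝓜.M) → ℂ := fun y ↦
      (Matrix.diagonal (fun i ↦ (δ i : ℂ)) * ((P y).toCols₂)⁻¹ * (P y).toCols₁) i j with hFdef
    have hFt : DifferentiableOn ℂ (F ∘ ct.symm) (ct '' W₂) := by
      have h := Literature.Analysis.Matrix.differentiableOn_siegelPoint_of_periodMatrix δ (P := fun z ↦ P (ct.symm z))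
        (s := ct '' W₂) (fun i' k ↦ (hPan i' k).differentiableOn) (fun z hz ↦ ?_) i j
      · exact h
      · obtain ⟨y, hy, rfl⟩ := hz
        rw [ct.left_inv (hW₂c hy)]
        exact (hPf y (hW₂W hy) hy).1.ne_zero
    -- hence in the chart at `x` ((R-b))
    have hFx := Motives.ComplexPoints.differentiableOn_comp_algebraicChart_symm_of_differentiableOn F t hW₂o hW₂c hFt x
    refine hFx.congr fun z hz ↦ ?_
    have hyW₂ : (ComplexPoints.algebraicChart ((Motives.baseChange ℚ ℂ).obj 𝓜.M) d x).symm z ∈ W₂ := hz.2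
    change π _ i j = F _
    rw [hππW ⟨_, hW₂W hyW₂⟩]
    exact congrFun (congrFun (hPf _ (hW₂W hyW₂) hyW₂).2 i) j
  refine ⟨π, fun x ↦ ⟨jOfSiegel δ (πW x), SiegelComplexRecordSystem.jOfSiegel_mem_C0pm hδ.1 (hZ x)⟩, mark, hmγ, hmΨ, hmu,
    fun x a ↦ ?_, fun x ↦ ?_, fun x ↦ ?_, ?_, ?_, ?_, fun i ↦ ?_⟩
  · -- the frame clause in the marking's currency
    exact frameClause_to_marking (mark x) (hmΨ x) (hmu x) _ (hframe x a)
  · -- the Gram clause in the marking's currency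
    exact gramClause_to_marking (mark x) (hmΨ x) (hmu x) (hφ x) (Θ x) (hAH x)
  · -- Siegel normalisation
    refine ⟨(hππW x).symm ▸ hZ x, Subtype.ext ?_⟩
    simp only [hππW x]
  · -- continuity on `W`
    intro t ht
    obtain ⟨W₂, hW₂o, htW₂, -, hW₂c, hdiff⟩ := hloc t ht
    set ct := ComplexPoints.algebraicChart ((Motives.baseChange ℚ ℂ).obj 𝓜.M) d t with hct
    refine ContinuousAt.continuousWithinAt (continuousAt_pi.2 fun i ↦ continuousAt_pi.2 fun j ↦ ?_)
    have hopen : IsOpen (ct.target ∩ ct.symm ⁻¹' W₂) := ct.isOpen_inter_preimage_symm hW₂o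
    have hmem : ct t ∈ ct.target ∩ ct.symm ⁻¹' W₂ :=
      ⟨ct.map_source (hW₂c htW₂), by rw [Set.mem_preimage, ct.left_inv (hW₂c htW₂)]; exact htW₂⟩
    have h1 : ContinuousAt ((fun y ↦ π y i j) ∘ ct.symm) (ct t) :=
      ((hdiff t i j).differentiableAt (hopen.mem_nhds hmem)).continuousAt
    rw [ct.symm.continuousAt_iff_continuousAt_comp_right (show t ∈ ct.symm.target from hW₂c htW₂), ct.symm_symm]
    exact h1
  · -- holomorphy in every algebraic chart over `W`
    intro x hx i j z hz
    obtain ⟨W₂, hW₂o, htW₂, -, -, hdiff⟩ := hloc _ hz.2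
    set cx := ComplexPoints.algebraicChart ((Motives.baseChange ℚ ℂ).obj 𝓜.M) d x with hcx
    have hopen : IsOpen (cx.target ∩ cx.symm ⁻¹' W₂) := cx.isOpen_inter_preimage_symm hW₂o
    exact ((hdiff x i j).differentiableAt (hopen.mem_nhds ⟨hz.1, htW₂⟩)).differentiableWithinAt
  · -- `π x₀ = Z₀`
    rw [hππW x₀]
    have hJ₀ : ∀ v, Φ x₀ (jOfSiegel δ Z₀ *ᵥ v) = Complex.I • Φ x₀ v := fun v ↦ by
      have h := m₀.Ψ_J v
      have h1 : (((m₀.γ⁻¹ : GL (Fin g ⊕ Fin g) ℚ) : Matrix (Fin g ⊕ Fin g) (Fin g ⊕ Fin g) ℚ).map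
          (algebraMap ℚ ℝ)) = 1 := by
        rw [hγ₀, inv_one, Units.val_one]; exact Matrix.map_one _ (map_zero _) (map_one _)
      rw [h1, Matrix.one_mulVec, Matrix.one_mulVec, hΨ₀] at h
      exact h
    exact (siegelPoint_eq_of_apply_jOfSiegel hδ.1 hZ₀ (Φ x₀) hJ₀ (Pi.basisFun ℂ (Fin g))).2.symm
  · -- the level sections read through `mark x₀`
    obtain ⟨v, hv⟩ := SiegelAdelicMarking.exists_adelicCongr_inv_one (a := r)
      (fun j => (((Pi.single i (1 : ZMod N) : Fin g ⊕ Fin g → ZMod N) j).val : ℚ) / N)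
    refine ⟨v, hv, ?_⟩
    rw [← Λ₀.lift_level i, htower (dvd_refl N) hN0 _ v hv, m₀.r_eq_toFun_proj_of_γ_eq_one hγ₀,
      (mark x₀).r_eq_toFun_proj_of_γ_eq_one (hmγ x₀), hu₀, hmu]
    rfl

end Main

end UeP4bHodgeFrameMarkings

end Summit.HodgeConjecture.HodgeConjecture.Theorems

end
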